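import Mathlib
import Summits.Ventures.PercRepro2.Defs
import Summits.Ventures.PercRepro2.Graph
import Summits.Ventures.PercRepro2.Harris
import Summits.Ventures.PercRepro2.Events
import Summits.Ventures.PercRepro2.Induced
import Summits.Ventures.PercRepro2.SeedSet
import Summits.Ventures.PercRepro2.CrossRootT
import Summits.Ventures.PercRepro2.BHKAvoid
import Summits.Ventures.PercRepro2.LemmaA
import Summits.Ventures.PercRepro2.GateDefs
import Summits.Ventures.PercRepro2.GateFrame
import Summits.Ventures.PercRepro2.GateShift
import Summits.Ventures.PercRepro2.GateAnatomy
import Summits.Ventures.PercRepro2.ZMeanBound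

/-!
# The general gate `(GATE A,B) = Gate.GateRow s {t} a b A B` (row 2′CON-W, `|T| = 1`): the two-class
anatomy, the shift theorem, the reduction to ONE conditional covariance, and the root-frame FKG
mechanism (blind cell PercRepro2, mine-c g8; MINE-C.md §15, proofs/MINEC-LSMGATE.md §8, §10)

Root `s`, avoided vertex `t`, markers `a, b`, gate sets `A, B` (the one-sided free gate is
`A = {u}, B = {w}`, the two-sided free edge is `A = B = {u, w}`). The gate
`R ∖ {C(s) hits A ∧ C(t) hits B}` is the disjoint union of `A₁ = R ∩ {C(t) avoids B}` and
`A₂ = {C(t) hits B} ∩ {s ↮ {t} ∪ A}` (`gate_eq_union`). Exactly as in `GateShift` / `GateAnatomy`: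

* `anatomy`: `P(A₁) P(A₂) E = P(A₂)(r² covA₁ + shiftA₁) + P(A₁)(r² covA₂ + shiftA₂)`;
* `shift_nonneg`: the shift part is `≥ 0` on EVERY graph — on `A₁` both shifts are `≥ 0`
  (`bhk_cross_clusterT` with the up-set `{W | W hits B}`), on `A₂` both are `≤ 0`
  (`bhk_cross_cluster_avoid` with the avoided set `{t} ∪ A`, then `shift_avoid_more`);
* `covA₁ ≥ 0` is `Gate.hull_frame_pa` (`covC_classA₁_nonneg`);
* hence `gateRow_of_covA₂`: `0 ≤ covA₂ → GateRow s {t} a b A B` — the whole row (at `|T| = 1`)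
  reduces to the single conditional covariance `Cov(X, Y ∣ s ↮ {t} ∪ A, C(t) hits B)`;
* `covC_classA₂_nonneg`: if the root-frame mass `W ↦ P(C(s) = W ∧ A₂)` is log-supermodular on
  `Finset V` (`MassA₂LogSupermod`) then `covA₂ ≥ 0` (four functions): **`gateRow_of_massA₂_logSupermod`**.
  On every forest the hypothesis holds for every `A, B` (the hitting events `{W hits P_b}`, `b ∈ B`, are
  nested on rooted subtrees — their generators are the medians of `s, t, b`, all on the `s–t` path;
  paper §10), so row 2′CON-W holds on every forest.
-/

namespace Summit.Ventures.PercRepro2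

namespace GateSplit

variable {V : Type*} {E : Type*} [Fintype E] [DecidableEq E] [Fintype V] [DecidableEq V]
  {R : Type*} [Field R] [LinearOrder R] [IsStrictOrderedRing R]

variable (p : E → R) (ends : E → Sym2 V) (s t a b : V) (A B : Finset V)

/-- The hull-hitting event `{C(t) hits B}` as a cluster event of `t`. -/
def hitsUW : Set (Config E) := clusterInEvent ends t {W : Set V | ∃ x ∈ B, x ∈ W}

/-- Class `A₁ = R ∩ {C(t) avoids B}`. -/
def classA₁ : Set (Config E) := avoidAll ends s {t} ∩ (hitsUW ends t B)ᶜ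

/-- Class `A₂ = {C(t) hits B} ∩ {s ↮ {t} ∪ A}`. -/
def classA₂ : Set (Config E) := hitsUW ends t B ∩ avoidAll ends s ({t} ∪ A)

omit [Fintype E] [DecidableEq E] [Fintype V] [DecidableEq V] [Field R] [LinearOrder R]
  [IsStrictOrderedRing R] in
/-- `{W | W hits B}` is an up-set. -/
lemma isUpperSet_mem_or : IsUpperSet {W : Set V | ∃ x ∈ B, x ∈ W} :=
  fun _ _ h ⟨x, hxB, hxW⟩ => ⟨x, hxB, h hxW⟩

omit [Fintype E] [DecidableEq E] [Fintype V] [DecidableEq V] [Field R] [LinearOrder R]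
  [IsStrictOrderedRing R] in
/-- `hitsUW` is the gate's `hitsK {t} B`. -/
lemma hitsUW_eq : hitsUW ends t B = Gate.hitsK ends {t} B := by
  ext ω
  simp [hitsUW, Gate.hitsK, clusterInEvent]

omit [Fintype E] [DecidableEq E] [Fintype V] [DecidableEq V] [Field R] [LinearOrder R]
  [IsStrictOrderedRing R] in
/-- The seed-set form of `hitsUW` (seed set `{t}`). -/
lemma clusterSetIn_eq_hitsUW :
    clusterSetInEvent ends {t} {W : Set V | ∃ x ∈ B, x ∈ W} = hitsUW ends t B := by
  ext ω
  simp [clusterSetInEvent, clusterSet, hitsUW, clusterInEvent, cluster]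

omit [Fintype E] [DecidableEq E] [Fintype V] [Field R] [LinearOrder R] [IsStrictOrderedRing R] in
/-- The gate is the union of the two classes. -/
lemma gate_eq_union :
    Gate.gateEvent ends s {t} A B = classA₁ ends s t B ∪ classA₂ ends s t A B := by
  ext ω
  simp only [Gate.gateEvent, Gate.hitsS, Gate.hitsK, classA₁, classA₂, hitsUW, avoidAll, clusterInEvent,
    cluster, Set.mem_inter_iff, Set.mem_compl_iff, Set.mem_setOf_eq, Set.mem_union, Finset.mem_singleton,
    Finset.mem_union, exists_eq_left, forall_eq, forall_eq_or_imp]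
  constructor
  · rintro ⟨hst, hn⟩
    by_cases hK : ∃ x ∈ B, Conn ends ω t x
    · exact Or.inr ⟨hK, hst, fun x hx hsx => hn ⟨⟨x, hx, hsx⟩, hK⟩⟩
    · exact Or.inl ⟨hst, hK⟩
  · rintro (⟨hst, hK⟩ | ⟨hK, hst, hS⟩)
    · exact ⟨hst, fun h => hK h.2⟩
    · exact ⟨hst, fun ⟨⟨x, hx, hsx⟩, _⟩ => hS x hx hsx⟩

omit [Fintype E] [DecidableEq E] [Fintype V] [Field R] [LinearOrder R] [IsStrictOrderedRing R] in
/-- The two classes are disjoint. -/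
lemma disjoint_classes : Disjoint (classA₁ ends s t B) (classA₂ ends s t A B) := by
  rw [Set.disjoint_left]
  rintro ω ⟨_, hA⟩ ⟨hB, _⟩
  exact hA hB

omit [Fintype V] [LinearOrder R] [IsStrictOrderedRing R] in
/-- Additivity of every mass over the partition. -/
lemma prob_inter_gate (X : Set (Config E)) :
    prob p (X ∩ Gate.gateEvent ends s {t} A B) =
      prob p (X ∩ classA₁ ends s t B) + prob p (X ∩ classA₂ ends s t A B) := by
  rw [gate_eq_union, Set.inter_union_distrib_left]
  exact prob_union_of_disjoint p
    (Set.disjoint_of_subset Set.inter_subset_right Set.inter_subset_right (disjoint_classes ends s t A B))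

omit [Fintype V] [LinearOrder R] [IsStrictOrderedRing R] in
/-- Additivity of the gate mass. -/
lemma prob_gate :
    prob p (Gate.gateEvent ends s {t} A B) =
      prob p (classA₁ ends s t B) + prob p (classA₂ ends s t A B) := by
  rw [gate_eq_union]
  exact prob_union_of_disjoint p (disjoint_classes ends s t A B)

/-- The cleared expression of `Gate.GateRow s {t} a b A B`. -/
noncomputable def gateExpr : R :=
  prob p (avoidAll ends s {t}) ^ 2 *
        prob p (connAll ends s ({a} ∪ {b}) ∩ Gate.gateEvent ends s {t} A B) -
      prob p (avoidAll ends s {t}) *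
        (prob p (connAll ends s {a} ∩ avoidAll ends s {t}) *
            prob p (connAll ends s {b} ∩ Gate.gateEvent ends s {t} A B) +
          prob p (connAll ends s {b} ∩ avoidAll ends s {t}) *
            prob p (connAll ends s {a} ∩ Gate.gateEvent ends s {t} A B)) +
      prob p (connAll ends s {a} ∩ avoidAll ends s {t}) *
        prob p (connAll ends s {b} ∩ avoidAll ends s {t}) *
          prob p (Gate.gateEvent ends s {t} A B)

omit [Fintype V] [IsStrictOrderedRing R] in
/-- `GateRow` is `0 ≤ gateExpr`. -/
lemma gateRow_iff :
    Gate.GateRow p ends s {t} a b A B ↔ 0 ≤ gateExpr p ends s t a b A B := Iff.rfl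

omit [Fintype V] [LinearOrder R] [IsStrictOrderedRing R] in
/-- **The anatomy identity** for the general gate. -/
theorem anatomy :
    prob p (classA₁ ends s t B) * prob p (classA₂ ends s t A B) * gateExpr p ends s t a b A B =
      prob p (classA₂ ends s t A B) *
          (prob p (avoidAll ends s {t}) ^ 2 * GateAnatomy.covC p ends s a b (classA₁ ends s t B) +
            GateAnatomy.shiftC p ends s t a b (classA₁ ends s t B)) +
        prob p (classA₁ ends s t B) *
          (prob p (avoidAll ends s {t}) ^ 2 * GateAnatomy.covC p ends s a b (classA₂ ends s t A B) +
            GateAnatomy.shiftC p ends s t a b (classA₂ ends s t A B)) := by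
  have e1 := prob_inter_gate p ends s t A B (connAll ends s ({a} ∪ {b}))
  have e2 := prob_inter_gate p ends s t A B (connAll ends s {a})
  have e3 := prob_inter_gate p ends s t A B (connAll ends s {b})
  have e4 := prob_gate p ends s t A B
  unfold gateExpr GateAnatomy.covC GateAnatomy.shiftC
  rw [e1, e2, e3, e4]
  ring

/-- **Class `A₁` shift** (`≥ 0`): `P(X; R) · P(A₁) ≤ P(R) · P(X; A₁)` — the marker event and
`{C(t) hits B}` are negatively correlated given `R`. -/
lemma shiftA₁_nonneg (hp : IsProbVec p) :
    prob p (connAll ends s {a} ∩ avoidAll ends s {t}) * prob p (classA₁ ends s t B) ≤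
      prob p (avoidAll ends s {t}) * prob p (connAll ends s {a} ∩ classA₁ ends s t B) := by
  have h := bhk_cross_clusterT p hp ends {t} s (𝓤 := {W : Set V | ∃ x ∈ B, x ∈ W})
    (𝓥 := {W : Set V | a ∈ W}) (isUpperSet_mem_or B) (GateShift.isUpperSet_mem a)
  rw [clusterSetIn_eq_hitsUW, GateShift.avoidAllT_singleton, GateShift.clusterInEvent_mem_eq_connAll ends s a] at h
  unfold classA₁
  have e1 := prob_inter_add_prob_inter_compl p (connAll ends s {a} ∩ avoidAll ends s {t}) (hitsUW ends t B)
  have e2 := prob_inter_add_prob_inter_compl p (avoidAll ends s {t}) (hitsUW ends t B)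
  have s1 : connAll ends s {a} ∩ avoidAll ends s {t} ∩ hitsUW ends t B =
      hitsUW ends t B ∩ connAll ends s {a} ∩ avoidAll ends s {t} := by
    ext ω; simp only [Set.mem_inter_iff]; tauto
  have s2 : avoidAll ends s {t} ∩ hitsUW ends t B = hitsUW ends t B ∩ avoidAll ends s {t} :=
    Set.inter_comm _ _
  have s3 : connAll ends s {a} ∩ avoidAll ends s {t} ∩ (hitsUW ends t B)ᶜ =
      connAll ends s {a} ∩ (avoidAll ends s {t} ∩ (hitsUW ends t B)ᶜ) := Set.inter_assoc _ _ _
  rw [s1, s3] at e1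
  rw [s2] at e2
  nlinarith [h, e1, e2, prob_nonneg hp (connAll ends s {a} ∩ avoidAll ends s {t}),
    prob_nonneg hp (avoidAll ends s {t})]

/-- **Class `A₂` shift** (`≤ 0`): `P(R) · P(X; A₂) ≤ P(X; R) · P(A₂)` — cross-cluster BHK with the
avoided set `{t} ∪ A`, then the avoided-set monotonicity. -/
lemma shiftA₂_nonpos (hp : IsProbVec p) :
    prob p (avoidAll ends s {t}) * prob p (connAll ends s {a} ∩ classA₂ ends s t A B) ≤
      prob p (connAll ends s {a} ∩ avoidAll ends s {t}) * prob p (classA₂ ends s t A B) := by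
  have ht : t ∈ ({t} ∪ A : Finset V) := by simp
  have h1 := bhk_cross_cluster_avoid p hp ends s t ht (𝓤 := {W : Set V | a ∈ W})
    (𝓥 := {W : Set V | ∃ x ∈ B, x ∈ W}) (GateShift.isUpperSet_mem a) (isUpperSet_mem_or B)
  rw [GateShift.clusterInEvent_mem_eq_connAll ends s a] at h1
  have h2 := MineCLemmas.shift_avoid_more p ends hp s {a} {t} A
  unfold classA₂
  set q := prob p (avoidAll ends s ({t} ∪ A)) with hq
  set r := prob p (avoidAll ends s {t}) with hr
  set xB := prob p (connAll ends s {a} ∩ (hitsUW ends t B ∩ avoidAll ends s ({t} ∪ A))) with hxB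
  set bB := prob p (hitsUW ends t B ∩ avoidAll ends s ({t} ∪ A)) with hbB
  set xq := prob p (connAll ends s {a} ∩ avoidAll ends s ({t} ∪ A)) with hxq
  set x := prob p (connAll ends s {a} ∩ avoidAll ends s {t}) with hx
  have e1 : connAll ends s {a} ∩ clusterInEvent ends t {W : Set V | ∃ x ∈ B, x ∈ W} ∩
      avoidAll ends s ({t} ∪ A) =
      connAll ends s {a} ∩ (hitsUW ends t B ∩ avoidAll ends s ({t} ∪ A)) :=
    Set.inter_assoc _ _ _
  rw [e1] at h1
  have e2 : clusterInEvent ends t {W : Set V | ∃ x ∈ B, x ∈ W} ∩ avoidAll ends s ({t} ∪ A) =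
      hitsUW ends t B ∩ avoidAll ends s ({t} ∪ A) := rfl
  rw [e2] at h1
  have hq0 : 0 ≤ q := prob_nonneg hp _
  have hr0 : 0 ≤ r := prob_nonneg hp _
  have hbB0 : 0 ≤ bB := prob_nonneg hp _
  have hx0 : 0 ≤ x := prob_nonneg hp _
  have hxB0 : 0 ≤ xB := prob_nonneg hp _
  rcases hq0.lt_or_eq with hqpos | hq0'
  · have := calc xB * q * r ≤ xq * bB * r := by nlinarith [h1, hr0]
      _ = (xq * r) * bB := by ring
      _ ≤ (x * q) * bB := by nlinarith [h2, hbB0]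
    have key : q * (r * xB - x * bB) ≤ 0 := by nlinarith [this]
    exact le_of_mul_le_mul_left (by linarith [key] : q * (r * xB) ≤ q * (x * bB)) hqpos
  · have hsub : hitsUW ends t B ∩ avoidAll ends s ({t} ∪ A) ⊆
        avoidAll ends s ({t} ∪ A) := Set.inter_subset_right
    have h3 : bB ≤ q := prob_mono hp hsub
    have h4 : xB ≤ bB := prob_mono hp Set.inter_subset_right
    have hbB : bB = 0 := by linarith
    have hxB : xB = 0 := by linarith
    rw [hbB, hxB]; simp

/-- **The shift part of the general gate is nonnegative** (every graph, every `A, B`):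
`0 ≤ P(A₂) shiftA₁ + P(A₁) shiftA₂`. -/
theorem shift_nonneg (hp : IsProbVec p) :
    0 ≤ prob p (classA₂ ends s t A B) * GateAnatomy.shiftC p ends s t a b (classA₁ ends s t B) +
      prob p (classA₁ ends s t B) * GateAnatomy.shiftC p ends s t a b (classA₂ ends s t A B) := by
  have hA1 := shiftA₁_nonneg p ends s t a B hp
  have hA2 := shiftA₁_nonneg p ends s t b B hp
  have hB1 := shiftA₂_nonpos p ends s t a A B hp
  have hB2 := shiftA₂_nonpos p ends s t b A B hp
  have hPA := prob_nonneg hp (classA₁ ends s t B)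
  have hPB := prob_nonneg hp (classA₂ ends s t A B)
  unfold GateAnatomy.shiftC
  have t1 : 0 ≤ prob p (avoidAll ends s {t}) * prob p (connAll ends s {a} ∩ classA₁ ends s t B) -
      prob p (connAll ends s {a} ∩ avoidAll ends s {t}) * prob p (classA₁ ends s t B) := by linarith
  have t2 : 0 ≤ prob p (avoidAll ends s {t}) * prob p (connAll ends s {b} ∩ classA₁ ends s t B) -
      prob p (connAll ends s {b} ∩ avoidAll ends s {t}) * prob p (classA₁ ends s t B) := by linarith
  have t3 : prob p (avoidAll ends s {t}) * prob p (connAll ends s {a} ∩ classA₂ ends s t A B) -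
      prob p (connAll ends s {a} ∩ avoidAll ends s {t}) * prob p (classA₂ ends s t A B) ≤ 0 := by linarith
  have t4 : prob p (avoidAll ends s {t}) * prob p (connAll ends s {b} ∩ classA₂ ends s t A B) -
      prob p (connAll ends s {b} ∩ avoidAll ends s {t}) * prob p (classA₂ ends s t A B) ≤ 0 := by linarith
  have m1 := mul_nonneg hPB (mul_nonneg t1 t2)
  have m2 := mul_nonneg hPA (mul_nonneg_of_nonpos_of_nonpos t3 t4)
  linarith

omit [Fintype E] [DecidableEq E] [Fintype V] [DecidableEq V] [Field R] [LinearOrder R]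
  [IsStrictOrderedRing R] in
/-- `A₁` is the hull frame `R ∩ {K avoids B}` of `Gate.hull_frame_pa`. -/
lemma classA₁_eq :
    classA₁ ends s t B = avoidAll ends s {t} ∩ (Gate.hitsK ends {t} B)ᶜ := by
  rw [classA₁, hitsUW_eq]

/-- **Class `A₁` is positively associated** (hull-frame BHK). -/
theorem covC_classA₁_nonneg (hp : IsProbVec p) :
    0 ≤ GateAnatomy.covC p ends s a b (classA₁ ends s t B) := by
  unfold GateAnatomy.covC
  rw [sub_nonneg, classA₁_eq]
  have := Gate.hull_frame_pa p ends s {t} B a b hp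
  linarith [this]

/-- **Reduction of the general gate to the within-class covariance of `A₂`**:
`0 ≤ covA₂ → GateRow s {t} a b A B` (both classes of positive mass). -/
theorem gateRow_of_covA₂ (hp : IsProbVec p) (hA : 0 < prob p (classA₁ ends s t B))
    (hB : 0 < prob p (classA₂ ends s t A B))
    (h : 0 ≤ GateAnatomy.covC p ends s a b (classA₂ ends s t A B)) :
    Gate.GateRow p ends s {t} a b A B := by
  rw [gateRow_iff]
  have hs := shift_nonneg p ends s t a b A B hp
  have h1 := covC_classA₁_nonneg p ends s t a b B hp
  have hr : 0 ≤ prob p (avoidAll ends s {t}) ^ 2 := sq_nonneg _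
  have hpa := hA.le
  have hpb := hB.le
  have key : 0 ≤ prob p (classA₁ ends s t B) * prob p (classA₂ ends s t A B) *
      gateExpr p ends s t a b A B := by
    rw [anatomy]
    nlinarith [hs, mul_nonneg hpb (mul_nonneg hr h1), mul_nonneg hpa (mul_nonneg hr h)]
  have hpos : 0 < prob p (classA₁ ends s t B) * prob p (classA₂ ends s t A B) := mul_pos hA hB
  exact (mul_nonneg_iff_of_pos_left hpos).1 key

/-! ## The root-frame FKG mechanism for `A₂` -/

/-- The class-`A₂` mass of the root cluster `W`: `P(C(s) = W ∧ A₂)`. -/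
noncomputable def massA₂ (W : Finset V) : R :=
  prob p (clusterEvent ends s (↑W : Set V) ∩ classA₂ ends s t A B)

/-- **The FKG lattice condition for the class-`A₂` mass** on `Finset V`. -/
def MassA₂LogSupermod : Prop :=
  ∀ W₁ W₂ : Finset V, massA₂ p ends s t A B W₁ * massA₂ p ends s t A B W₂ ≤
    massA₂ p ends s t A B (W₁ ∩ W₂) * massA₂ p ends s t A B (W₁ ∪ W₂)

omit [Fintype E] [DecidableEq E] [Fintype V] [Field R] [LinearOrder R] [IsStrictOrderedRing R] in
/-- On `{C(s) = W}` the event `{s ↔ x ∀ x ∈ X}` is decided by `W`. -/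
lemma clusterEvent_inter_connAll (W X : Finset V) (C : Set (Config E)) :
    clusterEvent ends s (↑W : Set V) ∩ (connAll ends s X ∩ C) =
      if X ⊆ W then clusterEvent ends s (↑W : Set V) ∩ C else ∅ := by
  split_ifs with h
  · ext ω
    simp only [Set.mem_inter_iff, mem_clusterEvent, connAll, Set.mem_setOf_eq]
    constructor
    · rintro ⟨hc, _, hC⟩; exact ⟨hc, hC⟩
    · rintro ⟨hc, hC⟩
      refine ⟨hc, fun x hx => ?_, hC⟩
      have : x ∈ cluster ends ω s := by rw [hc]; exact Finset.mem_coe.mpr (h hx)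
      exact this
  · ext ω
    simp only [Set.mem_inter_iff, mem_clusterEvent, connAll, Set.mem_setOf_eq, Set.mem_empty_iff_false,
      iff_false, not_and]
    intro hc hX _
    apply h
    intro x hx
    have : x ∈ cluster ends ω s := hX x hx
    rw [hc] at this
    exact Finset.mem_coe.mp this

omit [LinearOrder R] [IsStrictOrderedRing R] in
/-- `P(X; A₂) = Σ_W 1[X ⊆ W] · massA₂ W`. -/
lemma prob_connAll_inter_classA₂_eq_sum (X : Finset V) :
    prob p (connAll ends s X ∩ classA₂ ends s t A B) =
      ∑ W : Finset V, (if X ⊆ W then massA₂ p ends s t A B W else 0) := by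
  rw [prob_eq_sum_clusterEvent p ends s]
  refine Finset.sum_congr rfl fun W _ => ?_
  rw [clusterEvent_inter_connAll]
  unfold massA₂
  split_ifs <;> simp [prob]

omit [LinearOrder R] [IsStrictOrderedRing R] in
/-- `P(A₂) = Σ_W massA₂ W`. -/
lemma prob_classA₂_eq_sum :
    prob p (classA₂ ends s t A B) = ∑ W : Finset V, massA₂ p ends s t A B W := by
  rw [prob_eq_sum_clusterEvent p ends s]
  rfl

/-- **Class `A₂` is positively associated under the FKG lattice condition** (four functions). -/
theorem covC_classA₂_nonneg (hp : IsProbVec p) (h : MassA₂LogSupermod p ends s t A B) :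
    0 ≤ GateAnatomy.covC p ends s a b (classA₂ ends s t A B) := by
  classical
  unfold GateAnatomy.covC
  rw [sub_nonneg, prob_classA₂_eq_sum, prob_connAll_inter_classA₂_eq_sum,
    prob_connAll_inter_classA₂_eq_sum, prob_connAll_inter_classA₂_eq_sum]
  have hm0 : ∀ W, 0 ≤ massA₂ p ends s t A B W := fun W => prob_nonneg hp _
  have hχ0 : ∀ (X W : Finset V), (0 : R) ≤ if X ⊆ W then massA₂ p ends s t A B W else 0 :=
    fun X W => by split_ifs <;> simp [hm0]
  refine four_functions_theorem_univ (fun W => if {a} ⊆ W then massA₂ p ends s t A B W else 0)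
    (fun W => if {b} ⊆ W then massA₂ p ends s t A B W else 0) (fun W => massA₂ p ends s t A B W)
    (fun W => if {a} ∪ {b} ⊆ W then massA₂ p ends s t A B W else 0)
    (fun W => hχ0 _ W) (fun W => hχ0 _ W) hm0 (fun W => hχ0 _ W) ?_
  intro W₁ W₂
  by_cases ha : {a} ⊆ W₁
  · by_cases hb : {b} ⊆ W₂
    · have hab : {a} ∪ {b} ⊆ W₁ ⊔ W₂ :=
        Finset.union_subset (ha.trans Finset.subset_union_left) (hb.trans Finset.subset_union_right)
      rw [if_pos ha, if_pos hb, if_pos hab]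
      exact h W₁ W₂
    · rw [if_neg hb, mul_zero]
      exact mul_nonneg (hm0 _) (hχ0 _ _)
  · rw [if_neg ha, zero_mul]
    exact mul_nonneg (hm0 _) (hχ0 _ _)

/-- **The general gate under the FKG lattice condition on the class-`A₂` mass**: if
`W ↦ P(C(s) = W ∧ A₂)` is log-supermodular on `Finset V` and both classes have positive mass, then
`Gate.GateRow s {t} a b A B`. (Every forest satisfies the hypothesis for every `A, B` — paper.) -/
theorem gateRow_of_massA₂_logSupermod (hp : IsProbVec p)
    (hA : 0 < prob p (classA₁ ends s t B)) (hB : 0 < prob p (classA₂ ends s t A B))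
    (h : MassA₂LogSupermod p ends s t A B) :
    Gate.GateRow p ends s {t} a b A B :=
  gateRow_of_covA₂ p ends s t a b A B hp hA hB (covC_classA₂_nonneg p ends s t a b A B hp h)

end GateSplit

end Summit.Ventures.PercRepro2
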